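import Summits.AtomisticToContinuum.Crystallization.Theses.ExcessDecayLiouville

/-!
# `PhononStability` (stmt-AtomisticToContinuum-9333), negative side I: mirror, mutated statements, force-constant bounds

Route `ExcessDecayLiouville`, crux `PhononStability` (rank 4): uniform harmonic (acoustic +
optical) stability of Lennard-Jones over the admissible affine-hcp window,
`κ·Σ_{|p−q|≤11/10}‖u_p−u_q‖² ≤ ½Σ_{p≠q} Hess(p−q)(u_p−u_q)`.  This file (part I of the
load-bearing analysis by the standing disprover) names the crux's `let`-bound objects (`Λ₀`,
`Adm₀`, `Inner₀`, `Sites₀`, `Hess₀`, `nnForm`, `hessForm`), records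
`phononStability_iff : PhononStability ↔ …` (by `Iff.rfl`; the form provers `rw` into), states the
window-predicate form `PhononStabilityOn W` (the crux = `W = Adm ∧ Inner`, `phononStability_iff_on`;
the MUTATED statements of parts II/IV are `W = Inner₀` alone, `W = Adm₀` alone), and proves the
elementary facts every user of the crux needs: `V′(r) = −r⁻¹³ + r⁻⁷` and `V″(r) = 13r⁻¹⁴ − 7r⁻⁸`
as `deriv`s of `lennardJones` on `r ≠ 0`, the bound `|wᵀK(e)w| ≤ (|V″(|e|)| + |V′(|e|)|/|e|)‖w‖²`
(`≤ 904‖e‖⁻⁸` once `‖e‖ ≥ 1/2`, `‖w‖ = 1`), evenness of `K`, two-point `tsum`s, `nnForm ≥ 0`.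
All `[folklore]`.
-/

noncomputable section

namespace Summit.AtomisticToContinuum.Crystallization.Theorems.PhononStabilityNegative

open scoped BigOperators Topology Classical InnerProductSpace
open Filter Set Function
open Literature.MathematicalPhysics.StatisticalMechanics
open Summit.AtomisticToContinuum.Crystallization.Theses.ExcessDecayLiouville

local notation "E3" => EuclideanSpace ℝ (Fin 3)

/-! ## §0 Mirror of the crux's local definitions -/

/-- The hexagonal period lattice `Λ = ℤu + ℤv + ℤ·2√(2/3)e₃` of the unit hcp stacking
(verbatim the crux's `let Λ`). [folklore] -/
def Λ₀ : Set E3 :=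
  {z | ∃ i j k : ℤ, z = (i : ℝ) • triangularVec₁ 1 + (j : ℝ) • triangularVec₂ 1 +
    (k : ℝ) • layerNormal (2 * Real.sqrt (2 / 3))}

/-- Admissible cells: `‖A − 0.97·R‖ ≤ 1/40` for some linear isometry `R` (verbatim `let Adm`). [folklore] -/
def Adm₀ (A : E3 →L[ℝ] E3) : Prop :=
  ∃ R : E3 ≃ₗᵢ[ℝ] E3, ‖A - (97 / 100 : ℝ) • (R.toContinuousLinearEquiv : E3 →L[ℝ] E3)‖ ≤ 1 / 40

/-- hcp-like inner displacement (verbatim `let Inner`). [folklore] -/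
def Inner₀ (t : Fin 2 → E3) (A : E3 →L[ℝ] E3) : Prop :=
  ‖t 1 - t 0 - A (barlowOffset 1 + layerNormal (Real.sqrt (2 / 3)))‖ ≤ 1 / 40

/-- The site set `S = {t_m + A z}` (verbatim `let Sites`). [folklore] -/
def Sites₀ (t : Fin 2 → E3) (A : E3 →L[ℝ] E3) : Set E3 :=
  {p | ∃ m : Fin 2, ∃ z ∈ Λ₀, p = t m + A z}

/-- The LJ pair force-constant quadratic form `wᵀ K(e) w` (verbatim `let Hess`). [folklore] -/
def Hess₀ (e w : E3) : ℝ :=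
  deriv (deriv lennardJones) ‖e‖ * (inner ℝ e w / ‖e‖) ^ 2 +
    deriv lennardJones ‖e‖ / ‖e‖ * (‖w‖ ^ 2 - (inner ℝ e w / ‖e‖) ^ 2)

/-- Nearest-neighbour strain form (the crux's left-hand double sum). [folklore] -/
def nnForm (t : Fin 2 → E3) (A : E3 →L[ℝ] E3) (u : E3 → E3) : ℝ :=
  ∑' p : Sites₀ t A, ∑' q : Sites₀ t A,
    if dist (p : E3) q ≤ 11 / 10 then ‖u p - u q‖ ^ 2 else 0

/-- Second-variation double sum (the crux's right-hand double sum, before halving). [folklore] -/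
def hessForm (t : Fin 2 → E3) (A : E3 →L[ℝ] E3) (u : E3 → E3) : ℝ :=
  ∑' p : Sites₀ t A, ∑' q : Sites₀ t A,
    if (p : E3) ≠ q then Hess₀ ((p : E3) - q) (u p - u q) else 0

/-- The crux over the named mirror definitions (definitional unfolding only). [folklore] -/
theorem phononStability_iff :
    PhononStability ↔
      ∃ κ : ℝ, 0 < κ ∧ ∀ (t : Fin 2 → E3) (A : E3 →L[ℝ] E3), Adm₀ A → Inner₀ t A →
        ∀ u : E3 → E3, (Function.support u).Finite → Function.support u ⊆ Sites₀ t A →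
          κ * nnForm t A u ≤ hessForm t A u / 2 :=
  Iff.rfl

/-! ## Stability on a window predicate (the mutated statements) -/

/-- **Harmonic stability on a window predicate**: the crux's inequality with its two hypotheses
`Adm A`, `Inner t A` replaced by an arbitrary predicate `W t A` on the datum `(t, A)`.  The crux
is `PhononStabilityOn (fun t A => Adm₀ A ∧ Inner₀ t A)` (`phononStability_iff_on`); dropping a
hypothesis means enlarging `W` (parts II and IV refute `W = Inner₀` alone and `W = Adm₀` alone).
[folklore] -/
def PhononStabilityOn (W : (Fin 2 → E3) → (E3 →L[ℝ] E3) → Prop) : Prop :=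
  ∃ κ : ℝ, 0 < κ ∧ ∀ (t : Fin 2 → E3) (A : E3 →L[ℝ] E3), W t A →
    ∀ u : E3 → E3, (Function.support u).Finite → Function.support u ⊆ Sites₀ t A →
      κ * nnForm t A u ≤ hessForm t A u / 2

/-- The crux is stability on the admissible window `Adm A ∧ Inner t A`. [folklore] -/
theorem phononStability_iff_on :
    PhononStability ↔ PhononStabilityOn fun t A => Adm₀ A ∧ Inner₀ t A := by
  rw [phononStability_iff]
  unfold PhononStabilityOn
  constructor
  · rintro ⟨κ, hκ, h⟩
    exact ⟨κ, hκ, fun t A hW => h t A hW.1 hW.2⟩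
  · rintro ⟨κ, hκ, h⟩
    exact ⟨κ, hκ, fun t A hA hI => h t A ⟨hA, hI⟩⟩

/-- Stability on a window is monotone: it passes to smaller windows. [folklore] -/
theorem PhononStabilityOn.mono {W W' : (Fin 2 → E3) → (E3 →L[ℝ] E3) → Prop}
    (h : PhononStabilityOn W) (hle : ∀ t A, W' t A → W t A) : PhononStabilityOn W' := by
  unfold PhononStabilityOn at *
  obtain ⟨κ, hκ, h⟩ := h
  exact ⟨κ, hκ, fun t A hW' => h t A (hle t A hW')⟩

/-! ### Helper facts -/

/-- `V_LJ` is differentiable away from `0` with `V′(r) = -r⁻¹³ + r⁻⁷`. [folklore] -/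
theorem hasDerivAt_lennardJones {r : ℝ} (hr : r ≠ 0) :
    HasDerivAt lennardJones (-(r⁻¹) ^ 13 + (r⁻¹) ^ 7) r := by
  have h1 : HasDerivAt (fun y : ℝ => y⁻¹) (-(r ^ 2)⁻¹) r := hasDerivAt_inv hr
  have hfun : lennardJones = fun y : ℝ => (1 / 12 : ℝ) * (y⁻¹) ^ 12 - (1 / 6 : ℝ) * (y⁻¹) ^ 6 := by
    funext y; simp [lennardJones]
  rw [hfun]
  refine (((h1.pow 12).const_mul (1 / 12 : ℝ)).sub ((h1.pow 6).const_mul (1 / 6 : ℝ))).congr_deriv ?_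
  push_cast
  ring

/-- `V′(r) = -r⁻¹³ + r⁻⁷` for `r ≠ 0`, as a `deriv`. [folklore] -/
theorem deriv_lennardJones {r : ℝ} (hr : r ≠ 0) :
    deriv lennardJones r = -(r⁻¹) ^ 13 + (r⁻¹) ^ 7 :=
  (hasDerivAt_lennardJones hr).deriv

/-- A `tsum` over a two-element set. [folklore] -/
theorem tsum_pair {β : Type*} {a b : β} (hab : a ≠ b) (f : β → ℝ) :
    ∑' x : ({a, b} : Set β), f x = f a + f b := by
  have h : ({a, b} : Set β) = ((({a, b} : Finset β)) : Set β) := by simp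
  rw [h, Finset.tsum_subtype', Finset.sum_pair hab]

/-- A double `tsum` over a two-element set. [folklore] -/
theorem tsum_tsum_pair {β : Type*} {a b : β} (hab : a ≠ b) (F : β → β → ℝ) :
    ∑' p : ({a, b} : Set β), ∑' q : ({a, b} : Set β), F p q =
      F a a + F a b + (F b a + F b b) := by
  rw [tsum_pair hab (fun p => ∑' q : ({a, b} : Set β), F p q)]
  simp only [tsum_pair hab (F a), tsum_pair hab (F b)]

/-- `0 ∈ Λ`. [folklore] -/
theorem zero_mem_Λ₀ : (0 : E3) ∈ Λ₀ := ⟨0, 0, 0, by simp⟩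

/-- With the zero cell the site set collapses to the two sublattice origins. [folklore] -/
theorem sites₀_zero (t : Fin 2 → E3) : Sites₀ t 0 = {t 0, t 1} := by
  ext p
  simp only [Sites₀, _root_.zero_apply, add_zero, Set.mem_setOf_eq,
    Set.mem_insert_iff, Set.mem_singleton_iff]
  constructor
  · rintro ⟨m, z, -, rfl⟩
    fin_cases m <;> simp
  · rintro (rfl | rfl)
    · exact ⟨0, 0, zero_mem_Λ₀, rfl⟩
    · exact ⟨1, 0, zero_mem_Λ₀, rfl⟩

/-- On transverse displacements only the pre-stress term `V′(r)/r` of `K(e)` acts. [folklore] -/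
theorem Hess₀_of_inner_eq_zero {e w : E3} (h : inner ℝ e w = 0) :
    Hess₀ e w = deriv lennardJones ‖e‖ / ‖e‖ * ‖w‖ ^ 2 := by
  simp [Hess₀, h]

/-- `K(−e) = K(e)`: the form is even in the bond vector. [folklore] -/
theorem Hess₀_neg_left (e w : E3) : Hess₀ (-e) w = Hess₀ e w := by
  simp [Hess₀, norm_neg, inner_neg_left, neg_div]

/-- `wᵀK(e)w` is even in `w`. [folklore] -/
theorem Hess₀_neg_right (e w : E3) : Hess₀ e (-w) = Hess₀ e w := by
  simp [Hess₀, norm_neg, inner_neg_right, neg_div]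

/-- `0ᵀK(e)0 = 0`. [folklore] -/
@[simp] theorem Hess₀_zero_right (e : E3) : Hess₀ e 0 = 0 := by
  simp [Hess₀]

/-! ### The force-constant form: second derivative and a crude bound -/

/-- `V″(r) = 13 r⁻¹⁴ − 7 r⁻⁸` for `r ≠ 0`. [folklore] -/
theorem deriv_deriv_lennardJones {r : ℝ} (hr : r ≠ 0) :
    deriv (deriv lennardJones) r = 13 * (r⁻¹) ^ 14 - 7 * (r⁻¹) ^ 8 := by
  have hev : deriv lennardJones =ᶠ[𝓝 r] fun y => -(y⁻¹) ^ 13 + (y⁻¹) ^ 7 := by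
    filter_upwards [eventually_ne_nhds hr] with y hy using deriv_lennardJones hy
  rw [hev.deriv_eq]
  have h1 : HasDerivAt (fun y : ℝ => y⁻¹) (-(r ^ 2)⁻¹) r := hasDerivAt_inv hr
  have h := (h1.pow 13).neg.add (h1.pow 7)
  refine (h.deriv.trans ?_)
  push_cast
  ring

/-- Crude bound `|wᵀK(e)w| ≤ (|V″(|e|)| + |V′(|e|)|/|e|)·‖w‖²`. [folklore] -/
theorem abs_Hess₀_le (e w : E3) :
    |Hess₀ e w| ≤ (|deriv (deriv lennardJones) ‖e‖| + |deriv lennardJones ‖e‖| / ‖e‖) * ‖w‖ ^ 2 := by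
  unfold Hess₀
  set c := inner ℝ e w / ‖e‖ with hc
  have hc2 : c ^ 2 ≤ ‖w‖ ^ 2 := by
    rcases eq_or_ne e 0 with rfl | he
    · simp [hc]
    · have hpos : 0 < ‖e‖ := norm_pos_iff.2 he
      have hcs : |inner ℝ e w| ≤ ‖e‖ * ‖w‖ := abs_real_inner_le_norm e w
      have : |c| ≤ ‖w‖ := by
        rw [hc, abs_div, abs_of_pos hpos, div_le_iff₀ hpos]; linarith [mul_comm ‖e‖ ‖w‖]
      nlinarith [abs_nonneg c, sq_abs c]
  have h1 : |deriv (deriv lennardJones) ‖e‖ * c ^ 2| ≤ |deriv (deriv lennardJones) ‖e‖| * ‖w‖ ^ 2 := by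
    rw [abs_mul, abs_of_nonneg (sq_nonneg c)]
    exact mul_le_mul_of_nonneg_left hc2 (abs_nonneg _)
  have h2 : |deriv lennardJones ‖e‖ / ‖e‖ * (‖w‖ ^ 2 - c ^ 2)| ≤
      |deriv lennardJones ‖e‖| / ‖e‖ * ‖w‖ ^ 2 := by
    rw [abs_mul, abs_div, abs_norm, abs_of_nonneg (sub_nonneg.2 hc2)]
    exact mul_le_mul_of_nonneg_left (by nlinarith [sq_nonneg c]) (by positivity)
  calc _ ≤ |deriv (deriv lennardJones) ‖e‖ * c ^ 2| + |deriv lennardJones ‖e‖ / ‖e‖ * (‖w‖ ^ 2 - c ^ 2)| :=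
        abs_add_le _ _
    _ ≤ _ := by linarith

/-- For `‖e‖ ≥ 1/2` and `‖w‖ = 1`: `|wᵀK(e)w| ≤ 904·‖e‖⁻⁸`. [folklore] -/
theorem abs_Hess₀_le_inv_pow {e w : E3} (he : (1 / 2 : ℝ) ≤ ‖e‖) (hw : ‖w‖ = 1) :
    |Hess₀ e w| ≤ 904 * (‖e‖⁻¹) ^ 8 := by
  have hpos : 0 < ‖e‖ := by linarith
  have hne : ‖e‖ ≠ 0 := hpos.ne'
  refine (abs_Hess₀_le e w).trans ?_
  rw [hw, one_pow, mul_one, deriv_deriv_lennardJones hne, deriv_lennardJones hne]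
  set x := ‖e‖⁻¹ with hx
  have hx0 : 0 < x := inv_pos.2 hpos
  have hx2 : x ≤ 2 := by rw [hx]; exact inv_le_of_inv_le₀ (by norm_num) (by simpa using he)
  have hdiv : |-(x ^ 13) + x ^ 7| / ‖e‖ = |-(x ^ 13) + x ^ 7| * x := by rw [hx, div_eq_mul_inv]
  rw [hdiv]
  have hA : |13 * x ^ 14 - 7 * x ^ 8| ≤ 13 * x ^ 14 + 7 * x ^ 8 := by
    refine abs_le.2 ⟨?_, ?_⟩ <;> nlinarith [pow_nonneg hx0.le 14, pow_nonneg hx0.le 8]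
  have hB : |-(x ^ 13) + x ^ 7| ≤ x ^ 13 + x ^ 7 := by
    refine abs_le.2 ⟨?_, ?_⟩ <;> nlinarith [pow_nonneg hx0.le 13, pow_nonneg hx0.le 7]
  have hx6 : x ^ 6 ≤ 64 := by
    calc x ^ 6 ≤ 2 ^ 6 := pow_le_pow_left₀ hx0.le hx2 6
      _ = 64 := by norm_num
  have h8 : 0 ≤ x ^ 8 := pow_nonneg hx0.le 8
  calc |13 * x ^ 14 - 7 * x ^ 8| + |-(x ^ 13) + x ^ 7| * x
      ≤ (13 * x ^ 14 + 7 * x ^ 8) + (x ^ 13 + x ^ 7) * x := by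
        gcongr
    _ = 14 * (x ^ 8 * x ^ 6) + 8 * x ^ 8 := by ring
    _ ≤ 14 * (x ^ 8 * 64) + 8 * x ^ 8 := by gcongr
    _ = 904 * x ^ 8 := by ring

/-! ### The forms over the mirror definitions -/

/-- The nearest-neighbour strain form is `≥ 0` (a `tsum` of squares). [folklore] -/
theorem nnForm_nonneg (t : Fin 2 → E3) (A : E3 →L[ℝ] E3) (u : E3 → E3) : 0 ≤ nnForm t A u :=
  tsum_nonneg fun _ => tsum_nonneg fun _ => by split_ifs <;> positivity

end Summit.AtomisticToContinuum.Crystallization.Theorems.PhononStabilityNegative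

end
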